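import Literature.NumberTheory.Automorphic.Liu2021.LemD1DataOfPlace
import HarnessLib

/-!
# The doubled skew-hermitian plane `⟨ε₁⟩ ⊕ ⟨−ε₂⟩` of two lines is anisotropic iff the lines are in different classes

Topic `RepresentationTheory/MoeglinVignerasWaldspurger1987`; theorems only (no definition, no named fact).  First piece of the
«COMPACT (ANISOTROPIC) DOUBLING» discharge plan of the named fact `rankOne_theta_lines_disjoint`
(`RankOneThetaLiftLinesDisjoint.lean`, cell hodgecm-mathlib row IV-4(c1); plan of record, director g1 2026-08-28T03:03Z): the
theta dichotomy for the pair `(U(W_ε), U(V))` with `dim W = 1`, `dim V = 3` is attacked through the DOUBLED skew-hermitian plane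
`𝕎₂ := W_{ε₁} ⊕ (−W_{ε₂})` with Gram matrix `diag(ε₁, −ε₂)`; when `ε₁`, `ε₂ ∈ E_v^{−×}` lie in DIFFERENT classes of
`E_v^{−×}/Nm E_vˣ` this plane is ANISOTROPIC, so `U(𝕎₂)(F_v)` is compact and the see-saw needs no degenerate principal series
(contrast [HarrisKudlaSweet1996, §3–4], whose doubled space `W ⊕ (−W)` is split).

The elementary lemma recorded here, for a FIELD `K` with a ring endomorphism `c` («conjugation») and units `ε₁, ε₂`:

* `exists_isotropic_iff_sameClass` — the hermitian-type equation `ε₁ · x · c x = ε₂ · y · c y` has a solution `(x, y) ≠ (0, 0)`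
  iff `ε₂ = u · c u · ε₁` for a unit `u` (then `(x, y) = (u, 1)`; conversely `u = x / y`, both non-zero);
* `eq_zero_of_not_sameClass` — contrapositive, the shape used downstream: if the classes differ, `ε₁ x c x = ε₂ y c y` forces
  `x = y = 0`;
* `LemD1OfPlace.eps_doubledPlane_anisotropic` — the same AT THE TREE'S OBJECTS of `rankOne_theta_lines_disjoint`: `K = E_v`
  (`UnitaryGroup.LocalRing E v`, a field at a non-split place, hypothesis `IsField`), `c = conjLocal E c v`, `εᵢ = δᵢ ⊗ 1`
  (`LemD1OfPlace.eps`), class hypothesis literally c1's `¬ ∃ x, ε₂ = x · xᶜ · ε₁` (= `¬ LemD1.SameClass`, `sameClass_eps_iff`).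

Standard (Scharlau, *Quadratic and Hermitian Forms*, Ch. 10 §1: a binary (skew-)hermitian form `⟨a, −b⟩` over a quadratic
extension is isotropic iff `a b⁻¹` is a norm); stated for the equation, without introducing hermitian-space vocabulary.

## References
* [Liu2021] Y. Liu, Camb. J. Math. 9 (2021), App. D §D.1 Step 1 (l. 5217: `ε ∈ E^{−×}/Nm_{E/F} E^×`), Lem. D.1 (3) (l. 5233).
* [HarrisKudlaSweet1996] M. Harris, S. Kudla, W. J. Sweet, J. AMS 9 (1996) — §3–4 (the split doubling this plan avoids).
-/

noncomputable section

namespace Literature.RepresentationTheory.MoeglinVignerasWaldspurger1987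

/-! ## The field lemma -/

section Field

variable {K : Type*} [Field K] (c : K →+* K) (ε₁ ε₂ : Kˣ)

/-- **`⟨ε₁⟩ ⊕ ⟨−ε₂⟩` is isotropic iff `ε₁`, `ε₂` are in the same class.**  For a field `K`, a ring endomorphism `c` of `K` and
units `ε₁, ε₂`: the equation `ε₁ · x · c x = ε₂ · y · c y` has a solution with `(x, y) ≠ (0, 0)` iff `ε₂ = u · c u · ε₁` for some
unit `u` (Scharlau Ch. 10 §1; [Liu2021, App. D §D.1 Step 1]: the classes `E^{−×}/Nm E^×`). [cite: Liu2021, App. D §D.1 Step 1 (l. 5217)] -/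
theorem exists_isotropic_iff_sameClass :
    (∃ x y : K, (x ≠ 0 ∨ y ≠ 0) ∧ (ε₁ : K) * x * c x = ε₂ * y * c y) ↔
      ∃ u : Kˣ, ε₂ = u * Units.map (c : K →* K) u * ε₁ := by
  constructor
  · rintro ⟨x, y, hxy, h⟩
    have hy : y ≠ 0 := by
      rintro rfl
      simp only [map_zero, mul_zero] at h
      rcases hxy with hx | hy
      · exact (mul_ne_zero (mul_ne_zero ε₁.ne_zero hx) ((map_ne_zero c).mpr hx)) h
      · exact hy rfl
    have hx : x ≠ 0 := by
      rintro rfl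
      simp only [mul_zero, zero_mul] at h
      exact (mul_ne_zero (mul_ne_zero ε₂.ne_zero hy) ((map_ne_zero c).mpr hy)) h.symm
    refine ⟨Units.mk0 (x * y⁻¹) (mul_ne_zero hx (inv_ne_zero hy)), Units.ext ?_⟩
    simp only [Units.val_mul, Units.coe_map, MonoidHom.coe_coe, Units.val_mk0, map_mul, map_inv₀]
    have hcy : c y ≠ 0 := (map_ne_zero c).mpr hy
    field_simp
    linear_combination h.symm
  · rintro ⟨u, hu⟩
    refine ⟨u, 1, Or.inl u.ne_zero, ?_⟩
    have := congrArg (fun z : Kˣ => (z : K)) hu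
    simp only [Units.val_mul, Units.coe_map, MonoidHom.coe_coe] at this
    rw [this, map_one, mul_one, mul_one]
    ring

/-- **Different classes ⇒ the doubled plane is anisotropic** (the shape used by the compact-doubling argument): if
`ε₂ ≠ u · c u · ε₁` for every unit `u`, then `ε₁ x c x = ε₂ y c y` forces `x = 0` and `y = 0`.
[cite: Liu2021, App. D §D.1 Step 1 (l. 5217)] -/
theorem eq_zero_of_not_sameClass (hcls : ¬ ∃ u : Kˣ, ε₂ = u * Units.map (c : K →* K) u * ε₁) {x y : K}
    (h : (ε₁ : K) * x * c x = ε₂ * y * c y) : x = 0 ∧ y = 0 := by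
  by_contra hne
  refine hcls ((exists_isotropic_iff_sameClass c ε₁ ε₂).mp ⟨x, y, ?_, h⟩)
  by_contra hor
  push Not at hor
  exact hne ⟨hor.1, hor.2⟩

end Field

/-! ## At the tree's objects of `rankOne_theta_lines_disjoint` -/

section AtPlace

open NumberField IsDedekindDomain
open Literature.NumberTheory.Automorphic (UnitaryGroup.LocalRing UnitaryGroup.conjLocal)
open Literature.NumberTheory.Automorphic.Liu2021 (LemD1OfPlace.eps)

variable {F : Type} (E : Type) [Field F] [NumberField F] [Field E] [NumberField E] [Algebra F E]
  (v : HeightOneSpectrum (𝓞 F)) (c : E ≃ₐ[F] E)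
  {δ₁ δ₂ : E} (hδ₁ : δ₁ ≠ 0) (hδ₂ : δ₂ ≠ 0)

/-- **The doubled plane `⟨ε₁⟩ ⊕ ⟨−ε₂⟩` of `rankOne_theta_lines_disjoint` is anisotropic.**  At a NON-SPLIT place `v` (`E_v` a
field) and for Step-1 representatives `ε₁ = δ₁ ⊗ 1`, `ε₂ = δ₂ ⊗ 1 ∈ E_vˣ` in DIFFERENT classes — literally the class hypothesis
`¬ ∃ x, ε₂ = x · xᶜ · ε₁` of `rankOne_theta_lines_disjoint` (`= ¬ LemD1.SameClass`, `sameClass_eps_iff`) — the equation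
`ε₁ · x · xᶜ = ε₂ · y · yᶜ` in `E_v` has only the zero solution: the skew-hermitian plane `W_{ε₁} ⊕ (−W_{ε₂})` has no isotropic
vector, so its unitary group is compact.  This is what makes the doubling see-saw for two DIFFERENT lines elementary.
[cite: Liu2021, App. D §D.1 Step 1 (l. 5217) and Lem. D.1 (3) (l. 5233)] -/
theorem _root_.Literature.NumberTheory.Automorphic.Liu2021.LemD1OfPlace.eps_doubledPlane_anisotropic
    (hE : IsField (UnitaryGroup.LocalRing E v))
    (hcls : ¬ ∃ x : (UnitaryGroup.LocalRing E v)ˣ,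
      LemD1OfPlace.eps E v hδ₂ =
        x * Units.map (UnitaryGroup.conjLocal E c v : UnitaryGroup.LocalRing E v →* UnitaryGroup.LocalRing E v) x *
          LemD1OfPlace.eps E v hδ₁)
    {x y : UnitaryGroup.LocalRing E v}
    (h : (LemD1OfPlace.eps E v hδ₁ : UnitaryGroup.LocalRing E v) * x * UnitaryGroup.conjLocal E c v x =
      (LemD1OfPlace.eps E v hδ₂ : UnitaryGroup.LocalRing E v) * y * UnitaryGroup.conjLocal E c v y) :
    x = 0 ∧ y = 0 := by
  letI : Field (UnitaryGroup.LocalRing E v) := hE.toField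
  exact eq_zero_of_not_sameClass (UnitaryGroup.conjLocal E c v) (LemD1OfPlace.eps E v hδ₁) (LemD1OfPlace.eps E v hδ₂) hcls h

end AtPlace

end Literature.RepresentationTheory.MoeglinVignerasWaldspurger1987

end
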